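import Summits.CriticalPhenomena.PercolationContinuityZ3.Theorems.Transplant.SkelPhiNegReachRunB
import Summits.CriticalPhenomena.PercolationContinuityZ3.Theorems.Transplant.SkelPhiNegReachClausesB
import Summits.CriticalPhenomena.PercolationContinuityZ3.Theorems.Transplant.SkelPhiParaKitsCBandW
import HarnessLib

/-!
# N1 (the `{±1}` node), (C) column file (C-S7b), RULING B.15 (S1): THE KIT CLAUSES OF THE ONE-FRAME CORRIDOR DISCHARGED FROM THE STEP-I″ INPUTS AT
# EVERY CENTRE — `reachOblRHN_negSG₂b` (C-A7-b, p295916) with its two per-step kit premises `hkitsR₁` (signed v-rounds) and `hkitsR₂` (u-rounds ⧺ signed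
# band) served level by level by `hkits_vlocDHab` / `hkits_locHab` / `hkits_xbandHab` / `hkits_ybandHab` (C-S4) on the habitat facts of one corridor
# step `habStep_negSG₂b` (C-S7a): for every probe the plain window is centred at the ROOT `t` with depth `R := (E − L′) + r₀` (`E = E(nQ α y)`), so
# that the plain levels over every region lie in the fresh habitat (`r₀ + 3 ≤ L′ ≤ E₀`; rooms of the regions read with ONE unit of margin) and far /
# padded contacts send their inner neighbours beyond depth `E − L′` into the RIM PART — the D″ pattern `reachOblRH_of_stepI` (p5-g6) verbatim.
# Result **`Skelφ.reachOblRHN_negSG₂b_of_inputs`**: `Skel.ReachOblRHN` for the twin scheme of record from the concrete corridor records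
# (`vLocPrmD`, `xLocPrm`, `bandNw` := windowed x-band `xPrmWw` / y′-band `yPrmXw` by the corridor axis, windows `Wx` / `[−Wmy, Wpy]` free), the numeric rooms, the kit block, and the inputs at every
# centre (zone, abstract exit pieces `Pex`, long top pieces and side halves of both signs).

builds on p205010 (kernel theorem, internal audit signed; external expert review pending) — nothing in this file uses p205010; nothing here is a
claim about the open node `SamePDropOfSkeletonNeg`.
Lane `prim-bschramm`, seat `prim-bschramm-p5` (gen 9; (C) lineage); helper file (`--supports stmt-CriticalPhenomena-4575`).
[cite: KozmaNitzan2024, §4 Lemma 10 Steps III–V (pp. 19–22), Lemma 11 (pp. 22–23), Lemma 12 (pp. 23–25), p. 30 (Step IV), p. 31] [cite: MartineauTassion2017, §4.3 Lemma 4.2]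
-/

noncomputable section

open MeasureTheory

namespace Summit.CriticalPhenomena.PercolationContinuityZ3.Theorems

namespace Transplant

namespace Skelφ

open Literature.Probability.Percolation Literature.Probability.LatticeModels SimpleGraph GadgetSystem ProbeHistory HSiteScheme Contour KNCells
open KNCells.KSchA KNLevels ChainPlanar ChainPara
open Literature.Probability.Percolation.GM
open Literature.Probability.Percolation.KozmaNitzan.Cells (oth sgOf sgOf_sign stepVec_apply_fst stepVec_apply_oth)
open Literature.Barriers.CriticalPhenomena (graphBall graphBall_finite mem_graphBall_self graphBall_mono)
open BoxProdZ2 (ConcRadiiG nQ nS Erad Frad Erad_mono Frad_succ Frad_le_Erad Erad_add_gap_le_Frad_succ add_mul_le_Erad)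
open TwoAxis.Para (modulus)
open Skel (excess winGraph winGraphIn winGraphIn_le ReachOblAtHN ReachOblRHN l1_tgt_le_nQ isSubbox_Wcor_hab)
open SkelI (tanOff)

open scoped Classical

variable {V : Type} [DecidableEq V] {G : SimpleGraph V} [G.LocallyFinite] {φ : V → Site 2}

/-! ## The residue from the inputs at every centre -/

/-- **`Skel.ReachOblRHN` FOR THE TWIN SCHEME OF RECORD FROM THE INPUTS AT EVERY CENTRE** (the kit clauses of `reachOblRHN_negSG₂b` discharged; see the
module docstring). [cite: KozmaNitzan2024, §4 Lemmas 10–12 (pp. 17–25), p. 30 (Step IV), p. 31] -/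
theorem reachOblRHN_negSG₂b_of_inputs [Countable V] {types : Finset V} (hfr : Frames G φ types) (hκc : CylConn G φ types)
    {Δ : ℕ} (hΔ : ∀ v, G.degree v ≤ Δ) (hstep : Steps G φ) (hlipφ : Lip G φ) {t : V} {A : ℤ} (hA : 0 < A) {n : ℕ} (hn : 1 ≤ n)
    {h vα vβ : ℤ} (hm : 0 < modulus n h vα vβ) {c₀' c₁' s₀ s₁ D : ℤ} (hc₀' : 0 < c₀') (hc₁' : 0 < c₁') (hD : 0 < D)
    {kq : ℕ} (hκ : h.natAbs ≤ kq * n)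
    (F : V → Site 2) (hFdef : F = fineSkel φ t A n h vα vβ c₀' c₁' s₀ s₁ D) (hlipF : Lip G F) (hws : WeakSteps G F) (hF0 : F t = 0)
    (P : PCells2) (gap gap' : ℕ → ℕ) (E₀ L' : ℕ) (off : Site 2 → ℕ) (q : unitInterval) (δc : ℝ) (b₀ : Fin 2 → ℕ) (hb : ∀ i, b₀ i ≤ 3 * P.r i)
    (hΛ : WFS2 P (concRadii2N P gap gap' E₀ L' off)) (hgap : ∀ m, 20 * P.rmax ≤ gap m) {c : ℕ} (hgapc : ∀ m, c ≤ gap m)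
    (hoff : ∀ x : Site 2, off x ≤ c * ((x 0).natAbs + (x 1).natAbs) + 1) (hE₀ : 3 ≤ E₀) (hgapL : ∀ ρ, L' ≤ gap ρ)
    (hcol : ∀ a x, ∃ y ∈ VWin G F t (P.Q x) ((concRadii2N P gap gap' E₀ L' off).rQ a x), F y = P.cen x)
    -- the column vertices (bases of the run frames)
    (cOf : ℕ → Site 2 → V) (hcF : ∀ a y, F (cOf a y) = P.cen y)
    (hcQ : ∀ a y, cOf a y ∈ VWin G F t (P.Q y) ((concRadii2N P gap gap' E₀ L' off).rQ a y))
    {cC dC : ℕ} (hcD : ∀ a (y : Site 2), cOf a y ∈ graphBall G t (cC * ((y 0).natAbs + (y 1).natAbs) + dC)) (hgapC : ∀ m, cC ≤ gap m)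
    -- the long data of the strides and the concrete corridor records
    {ℓ : ℕ} (hvn : |vα| ≤ n) (hlay : 2 * ((n + h.natAbs : ℕ) : ℤ) ≤ (n : ℤ) * ℓ + 1) {eA WA L0A NA WB L0B NB qx Nx qy Ny Wx Wmy Wpy : ℕ}
    (hWn : n ≤ WA) (heA : ((eA : ℤ) + 2) * ((n + h.natAbs : ℕ) : ℤ) ≤ (n : ℤ) * ℓ + 1) (heAn : eA ≤ n) (hWB : n * ℓ / shearUnit n h + 1 ≤ WB)
    (hWx : n * ℓ / shearUnit n h + 1 ≤ Wx) (hWmy : (n + vα).toNat ≤ Wmy) (hWpy : (n - vα).toNat ≤ Wpy)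
    -- segment A: the arrival box `cen ± b₀` read into the v-rounds' start box
    {aW Bx bL : ℤ}
    (ha : D * (c₁' * (n : ℤ) * ((b₀ 0 : ℕ) + 1) + c₀' * |vα| * ((b₀ 1 : ℕ) + 1)) ≤ c₀' * c₁' * A * modulus n h vα vβ * aW)
    (hBx : D * (((b₀ 1 : ℕ) : ℤ) + 1) ≤ c₁' * A * Bx) (hb' : Bx / (shearUnit n h : ℤ) + 1 ≤ bL) (haW : aW ≤ WA) (hbL : bL ≤ L0A)
    -- the joins
    (hjoin : ∀ du, ((xLocPrm n ℓ h eA WB L0B NB).scheduleN 0 0 (xLocPrm_ok heAn hWB L0B NB)).core (NB + 1) ⊆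
      ((bandNw n ℓ h vα eA qx Nx qy Ny Wx Wmy Wpy du).scheduleN du.1 (sgOf_sign du) 0 (bandNw_ok hn hvn hlay eA qx Nx qy Ny hWx hWmy hWpy du) (bandNw_eb n ℓ h vα eA qx Nx qy Ny Wx Wmy Wpy du)).core 0)
    (hreg : ∀ du, ((bandNw n ℓ h vα eA qx Nx qy Ny Wx Wmy Wpy du).scheduleN du.1 (sgOf_sign du) 0 (bandNw_ok hn hvn hlay eA qx Nx qy Ny hWx hWmy hWpy du) (bandNw_eb n ℓ h vα eA qx Nx qy Ny Wx Wmy Wpy du)).core 0 ⊆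
      ((xLocPrm n ℓ h eA WB L0B NB).scheduleN 0 0 (xLocPrm_ok heAn hWB L0B NB)).region NB)
    (hjoinA : ((vLocPrmD n ℓ h vα eA WA L0A NA).scheduleN 1 0 (vLocPrmD_ok hn hvn hWn heA L0A NA) (vLocPrmD_dL hvn eA WA L0A NA)).core (NA + 1) ⊆
      ((xLocPrm n ℓ h eA WB L0B NB).scheduleN 0 0 (xLocPrm_ok heAn hWB L0B NB)).core 0)
    -- the rooms as reading inequalities: segment A (axis `1`), segment B (axis `0`), the band, the last core (SMALL box)
    (hrdA : ∀ du : MDir, ∀ k ≤ (vLocPrmD n ℓ h vα eA WA L0A NA).N,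
      let lo := dLo 1 1 0 (-((vLocPrmD n ℓ h vα eA WA L0A NA).toLoc.L k + (vLocPrmD n ℓ h vα eA WA L0A NA).e + (vLocPrmD n ℓ h vα eA WA L0A NA).La)) ((vLocPrmD n ℓ h vα eA WA L0A NA).toLoc.L k + (vLocPrmD n ℓ h vα eA WA L0A NA).e + (vLocPrmD n ℓ h vα eA WA L0A NA).La) (-((vLocPrmD n ℓ h vα eA WA L0A NA).Wk k + (vLocPrmD n ℓ h vα eA WA L0A NA).e + (vLocPrmD n ℓ h vα eA WA L0A NA).Lb)) ((vLocPrmD n ℓ h vα eA WA L0A NA).Wk k + (vLocPrmD n ℓ h vα eA WA L0A NA).e + (vLocPrmD n ℓ h vα eA WA L0A NA).Lb)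
      let hi := dHi 1 1 0 (-((vLocPrmD n ℓ h vα eA WA L0A NA).toLoc.L k + (vLocPrmD n ℓ h vα eA WA L0A NA).e + (vLocPrmD n ℓ h vα eA WA L0A NA).La)) ((vLocPrmD n ℓ h vα eA WA L0A NA).toLoc.L k + (vLocPrmD n ℓ h vα eA WA L0A NA).e + (vLocPrmD n ℓ h vα eA WA L0A NA).La) (-((vLocPrmD n ℓ h vα eA WA L0A NA).Wk k + (vLocPrmD n ℓ h vα eA WA L0A NA).e + (vLocPrmD n ℓ h vα eA WA L0A NA).Lb)) ((vLocPrmD n ℓ h vα eA WA L0A NA).Wk k + (vLocPrmD n ℓ h vα eA WA L0A NA).e + (vLocPrmD n ℓ h vα eA WA L0A NA).Lb)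
      (sgOf du = 1 → -(5 * (P.r du.1 : ℤ)) ≤ rdLo A n h vα vβ c₀' c₁' D lo hi du.1 ∧ rdHi A n h vα vβ c₀' c₁' D lo hi du.1 ≤ 22 * (P.r du.1 : ℤ)) ∧
      (sgOf du = -1 → -(5 * (P.r du.1 : ℤ)) ≤ -rdHi A n h vα vβ c₀' c₁' D lo hi du.1 ∧ -rdLo A n h vα vβ c₀' c₁' D lo hi du.1 ≤ 22 * (P.r du.1 : ℤ)) ∧
      (-(2 * (P.r (oth du.1) : ℤ)) ≤ rdLo A n h vα vβ c₀' c₁' D lo hi (oth du.1) ∧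
        rdHi A n h vα vβ c₀' c₁' D lo hi (oth du.1) ≤ 2 * (P.r (oth du.1) : ℤ)))
    (hrd₂ : ∀ du : MDir, ∀ k ≤ (xLocPrm n ℓ h eA WB L0B NB).N,
      let lo := dLo 0 1 0 (-((xLocPrm n ℓ h eA WB L0B NB).L k + (xLocPrm n ℓ h eA WB L0B NB).e + (xLocPrm n ℓ h eA WB L0B NB).La)) ((xLocPrm n ℓ h eA WB L0B NB).L k + (xLocPrm n ℓ h eA WB L0B NB).e + (xLocPrm n ℓ h eA WB L0B NB).La) (-((xLocPrm n ℓ h eA WB L0B NB).Wk k + (xLocPrm n ℓ h eA WB L0B NB).e + (xLocPrm n ℓ h eA WB L0B NB).Lb)) ((xLocPrm n ℓ h eA WB L0B NB).Wk k + (xLocPrm n ℓ h eA WB L0B NB).e + (xLocPrm n ℓ h eA WB L0B NB).Lb)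
      let hi := dHi 0 1 0 (-((xLocPrm n ℓ h eA WB L0B NB).L k + (xLocPrm n ℓ h eA WB L0B NB).e + (xLocPrm n ℓ h eA WB L0B NB).La)) ((xLocPrm n ℓ h eA WB L0B NB).L k + (xLocPrm n ℓ h eA WB L0B NB).e + (xLocPrm n ℓ h eA WB L0B NB).La) (-((xLocPrm n ℓ h eA WB L0B NB).Wk k + (xLocPrm n ℓ h eA WB L0B NB).e + (xLocPrm n ℓ h eA WB L0B NB).Lb)) ((xLocPrm n ℓ h eA WB L0B NB).Wk k + (xLocPrm n ℓ h eA WB L0B NB).e + (xLocPrm n ℓ h eA WB L0B NB).Lb)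
      (sgOf du = 1 → -(5 * (P.r du.1 : ℤ)) ≤ rdLo A n h vα vβ c₀' c₁' D lo hi du.1 ∧ rdHi A n h vα vβ c₀' c₁' D lo hi du.1 ≤ 22 * (P.r du.1 : ℤ)) ∧
      (sgOf du = -1 → -(5 * (P.r du.1 : ℤ)) ≤ -rdHi A n h vα vβ c₀' c₁' D lo hi du.1 ∧ -rdLo A n h vα vβ c₀' c₁' D lo hi du.1 ≤ 22 * (P.r du.1 : ℤ)) ∧
      (-(2 * (P.r (oth du.1) : ℤ)) ≤ rdLo A n h vα vβ c₀' c₁' D lo hi (oth du.1) ∧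
        rdHi A n h vα vβ c₀' c₁' D lo hi (oth du.1) ≤ 2 * (P.r (oth du.1) : ℤ)))
    (hrdB : ∀ du : MDir, ∀ j ≤ (bandNw n ℓ h vα eA qx Nx qy Ny Wx Wmy Wpy du).N,
      let lo := dLo du.1 (sgOf du) 0 ((bandNw n ℓ h vα eA qx Nx qy Ny Wx Wmy Wpy du).aLo j - (bandNw n ℓ h vα eA qx Nx qy Ny Wx Wmy Wpy du).ea - (bandNw n ℓ h vα eA qx Nx qy Ny Wx Wmy Wpy du).La) ((bandNw n ℓ h vα eA qx Nx qy Ny Wx Wmy Wpy du).aHi j + (bandNw n ℓ h vα eA qx Nx qy Ny Wx Wmy Wpy du).ea + (bandNw n ℓ h vα eA qx Nx qy Ny Wx Wmy Wpy du).La)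
        ((bandNw n ℓ h vα eA qx Nx qy Ny Wx Wmy Wpy du).bLo j - (bandNw n ℓ h vα eA qx Nx qy Ny Wx Wmy Wpy du).eb - (bandNw n ℓ h vα eA qx Nx qy Ny Wx Wmy Wpy du).Lb) ((bandNw n ℓ h vα eA qx Nx qy Ny Wx Wmy Wpy du).bHi j + (bandNw n ℓ h vα eA qx Nx qy Ny Wx Wmy Wpy du).eb + (bandNw n ℓ h vα eA qx Nx qy Ny Wx Wmy Wpy du).Lb)
      let hi := dHi du.1 (sgOf du) 0 ((bandNw n ℓ h vα eA qx Nx qy Ny Wx Wmy Wpy du).aLo j - (bandNw n ℓ h vα eA qx Nx qy Ny Wx Wmy Wpy du).ea - (bandNw n ℓ h vα eA qx Nx qy Ny Wx Wmy Wpy du).La) ((bandNw n ℓ h vα eA qx Nx qy Ny Wx Wmy Wpy du).aHi j + (bandNw n ℓ h vα eA qx Nx qy Ny Wx Wmy Wpy du).ea + (bandNw n ℓ h vα eA qx Nx qy Ny Wx Wmy Wpy du).La)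
        ((bandNw n ℓ h vα eA qx Nx qy Ny Wx Wmy Wpy du).bLo j - (bandNw n ℓ h vα eA qx Nx qy Ny Wx Wmy Wpy du).eb - (bandNw n ℓ h vα eA qx Nx qy Ny Wx Wmy Wpy du).Lb) ((bandNw n ℓ h vα eA qx Nx qy Ny Wx Wmy Wpy du).bHi j + (bandNw n ℓ h vα eA qx Nx qy Ny Wx Wmy Wpy du).eb + (bandNw n ℓ h vα eA qx Nx qy Ny Wx Wmy Wpy du).Lb)
      (sgOf du = 1 → -(5 * (P.r du.1 : ℤ)) ≤ rdLo A n h vα vβ c₀' c₁' D lo hi du.1 ∧ rdHi A n h vα vβ c₀' c₁' D lo hi du.1 ≤ 22 * (P.r du.1 : ℤ)) ∧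
      (sgOf du = -1 → -(5 * (P.r du.1 : ℤ)) ≤ -rdHi A n h vα vβ c₀' c₁' D lo hi du.1 ∧ -rdLo A n h vα vβ c₀' c₁' D lo hi du.1 ≤ 22 * (P.r du.1 : ℤ)) ∧
      (-(2 * (P.r (oth du.1) : ℤ)) ≤ rdLo A n h vα vβ c₀' c₁' D lo hi (oth du.1) ∧
        rdHi A n h vα vβ c₀' c₁' D lo hi (oth du.1) ≤ 2 * (P.r (oth du.1) : ℤ)))
    (hrdL : ∀ du : MDir,
      let lo := dLo du.1 (sgOf du) 0 ((bandNw n ℓ h vα eA qx Nx qy Ny Wx Wmy Wpy du).aLo ((bandNw n ℓ h vα eA qx Nx qy Ny Wx Wmy Wpy du).N + 1)) ((bandNw n ℓ h vα eA qx Nx qy Ny Wx Wmy Wpy du).aHi ((bandNw n ℓ h vα eA qx Nx qy Ny Wx Wmy Wpy du).N + 1)) ((bandNw n ℓ h vα eA qx Nx qy Ny Wx Wmy Wpy du).bLo ((bandNw n ℓ h vα eA qx Nx qy Ny Wx Wmy Wpy du).N + 1)) ((bandNw n ℓ h vα eA qx Nx qy Ny Wx Wmy Wpy du).bHi ((bandNw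 n ℓ h vα eA qx Nx qy Ny Wx Wmy Wpy du).N + 1))
      let hi := dHi du.1 (sgOf du) 0 ((bandNw n ℓ h vα eA qx Nx qy Ny Wx Wmy Wpy du).aLo ((bandNw n ℓ h vα eA qx Nx qy Ny Wx Wmy Wpy du).N + 1)) ((bandNw n ℓ h vα eA qx Nx qy Ny Wx Wmy Wpy du).aHi ((bandNw n ℓ h vα eA qx Nx qy Ny Wx Wmy Wpy du).N + 1)) ((bandNw n ℓ h vα eA qx Nx qy Ny Wx Wmy Wpy du).bLo ((bandNw n ℓ h vα eA qx Nx qy Ny Wx Wmy Wpy du).N + 1)) ((bandNw n ℓ h vα eA qx Nx qy Ny Wx Wmy Wpy du).bHi ((bandNw n ℓ h vα eA qx Nx qy Ny Wx Wmy Wpy du).N + 1))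
      (sgOf du = 1 → 20 * (P.r du.1 : ℤ) - (b₀ du.1 : ℕ) + 1 ≤ rdLo A n h vα vβ c₀' c₁' D lo hi du.1 ∧
        rdHi A n h vα vβ c₀' c₁' D lo hi du.1 ≤ 20 * (P.r du.1 : ℤ) + (b₀ du.1 : ℕ) - 1) ∧
      (sgOf du = -1 → 20 * (P.r du.1 : ℤ) - (b₀ du.1 : ℕ) + 1 ≤ -rdHi A n h vα vβ c₀' c₁' D lo hi du.1 ∧
        -rdLo A n h vα vβ c₀' c₁' D lo hi du.1 ≤ 20 * (P.r du.1 : ℤ) + (b₀ du.1 : ℕ) - 1) ∧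
      (-((b₀ (oth du.1) : ℕ) : ℤ) + 1 ≤ rdLo A n h vα vβ c₀' c₁' D lo hi (oth du.1) ∧ rdHi A n h vα vβ c₀' c₁' D lo hi (oth du.1) ≤ ((b₀ (oth du.1) : ℕ) : ℤ) - 1))
    (hbr : ∀ i, ((b₀ i : ℕ) : ℤ) ≤ 2 * (P.r i : ℤ))
    -- the band's habitat points
    (zB : MDir → ℕ → Site 2) (hzB : ∀ du j, 1 ≤ j → j ≤ (bandNw n ℓ h vα eA qx Nx qy Ny Wx Wmy Wpy du).N + 1 → zB du j ∈ (bandNw n ℓ h vα eA qx Nx qy Ny Wx Wmy Wpy du).pcore du.1 (sgOf du) 0 j) {Zmax : ℕ}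
    (hZ : ∀ du j, ((zB du j) 0).natAbs + ((zB du j) 1).natAbs ≤ Zmax)
    (hrdZ : ∀ du j,
      (sgOf du = 1 → -(5 * (P.r du.1 : ℤ)) + 1 ≤ rdLo A n h vα vβ c₀' c₁' D (zB du j) (zB du j) du.1 ∧
        rdHi A n h vα vβ c₀' c₁' D (zB du j) (zB du j) du.1 ≤ 22 * (P.r du.1 : ℤ) - 1) ∧
      (sgOf du = -1 → -(5 * (P.r du.1 : ℤ)) + 1 ≤ -rdHi A n h vα vβ c₀' c₁' D (zB du j) (zB du j) du.1 ∧
        -rdLo A n h vα vβ c₀' c₁' D (zB du j) (zB du j) du.1 ≤ 22 * (P.r du.1 : ℤ) - 1) ∧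
      (-(2 * (P.r (oth du.1) : ℤ)) + 1 ≤ rdLo A n h vα vβ c₀' c₁' D (zB du j) (zB du j) (oth du.1) ∧
        rdHi A n h vα vβ c₀' c₁' D (zB du j) (zB du j) (oth du.1) ≤ 2 * (P.r (oth du.1) : ℤ) - 1))
    (hE₀Z : dC + (kq + 3) * Zmax + 3 ≤ E₀)
    {nmax : ℕ} (hlen : ∀ du, (vLocPrmD n ℓ h vα eA WA L0A NA).N + 1 + ((xLocPrm n ℓ h eA WB L0B NB).N + 1 + (bandNw n ℓ h vα eA qx Nx qy Ny Wx Wmy Wpy du).N) ≤ nmax)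
    -- kit constants, count, excess radius
    {Rlev Nk j₀ j₁ : ℕ} (hRl : Rlev + 1 ≤ eA) (hj : j₁ ≤ Rlev)
    {δ η : ℝ} (hcount : 1 / (1 - (q : ℝ)) ^ (Δ * Nk) ≤ δ * ((Finset.Icc j₀ j₁).card : ℝ)) (hη : η ≤ δ / 2)
    {Rex : ℕ → ℕ}
    (hRex : ∀ R₀' R₁, Rex R₀' ≤ R₁ → ∀ (Rw : ℕ) (D' A' : Finset V), (∀ d ∈ D', d ∈ graphBall G t Rw) →
      (∀ d ∈ D', ∀ d' ∈ D', F d - F d' ∈ box 2 (50 * P.rmax)) → A' ⊆ D' → (∀ a ∈ A', a ∈ graphBall G t R₀') →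
        (bondPercolation G q).real (excess G t R₁ D' A') ≤ η)
    (hsch : ∀ g, Rex (Erad gap gap' E₀ g + 1) + L' ≤ Erad gap gap' E₀ (g + 1))
    -- the kit block
    (Pk : ApronPrm) {Rs Kmax KCmax rs cS cU Mz kz : ℕ} (hPN : kq + 3 ≤ Pk.N) (hAk : Pk.A = (Mz + 1 : ℕ) * (shearUnit n h : ℤ) + 1)
    (hd1 : Pk.W + Pk.ℓ ≤ Pk.d) (hD1 : Pk.W + Pk.ℓ + Pk.d + 2 ≤ shellD Pk) (hD2 : Pk.ℓ + Rs + Pk.d + 3 ≤ shellD Pk) (hDρ : Rs + 1 ≤ shellD Pk)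
    (hℓk : 1 ≤ Pk.ℓ) (hWk : Rs + Pk.ℓ ≤ Pk.W) (hKmax : (shellD Pk + Pk.W) * (kq + 1) ≤ Kmax) (hKCmax : (shellD Pk + Mz + 1) * (kq + 1) ≤ KCmax)
    (hR'k : cylRadMax G φ types Pk.ℓ (Rs + KCmax + (Pk.W + Kmax)) ≤ Pk.R')
    (hT : (Pk.W : ℤ) + Kmax + Pk.ℓ + 1 ≤ tanOff Pk.ℓs Pk.M) (hT' : (shellD Pk : ℤ) + KCmax + Rs ≤ tanOff Pk.ℓs Pk.M)
    (hr₀ : Pk.N * (tanOff Pk.ℓs Pk.M + 2) + Pk.N * Pk.d + (Pk.W + Kmax + Pk.R') + (KCmax + Rs) ≤ Pk.r₀)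
    (hrs : 2 * (1 + Pk.N * (tanOff Pk.ℓs Pk.M + 2) + Pk.N * Pk.d + (Pk.W + Kmax + Pk.R') + (KCmax + Rs)) ≤ rs)
    (hcS : (Pk.N + 1) * (tanOff Pk.ℓs Pk.M + 1) + (Pk.N + 1) * Pk.d + (2 * Pk.W + 1) * (Kmax + 1) * (Δ + 1) ^ Pk.R' ≤ cS)
    (hj₀T : tanOff Pk.ℓs Pk.M ≤ j₀) (hjreach : j₁ + (Pk.N * (tanOff Pk.ℓs Pk.M + 1) + Pk.N * Pk.d + KCmax) ≤ eA)
    {Rl : ℕ} (hRlreach : Rl + (Pk.N * (tanOff Pk.ℓs Pk.M + 1) + Pk.N * Pk.d + KCmax) ≤ Pk.r₀)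
    (Rg : V → Finset V) (hRg : ∀ c, ∀ u ∈ Rg c, u ∈ graphBall G c Rs) (hRgcard : ∀ c, (Rg c).card ≤ cU) (hcU1 : 1 ≤ cU)
    (Λc : V → ℕ → Finset V) (hkn : ∀ c, Λc c kz ⊆ Λc c Mz) (hΛz : ∀ c, ∀ v ∈ Λc c Mz, v ∈ Rg c ∧ φ v - φ c ∈ box 2 Mz)
    (hZc : ∀ c, (↑(Λc c Mz) : Set V) ⊆ cyl φ c Mz) (hMz : Mz < n) (hclear : (Mz + 4) * (n + h.natAbs) ≤ n * (ℓ + 1))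
    (Pex : Fin 2 → ℤˣ → V → Finset V)
    (hPex : ∀ (cb : V) (Lo Hi : Site 2) (i : Fin 2) (σ₀ : ℤˣ) (c : V), ∀ v ∈ Pex i σ₀ c, v ∈ Rg c ∧
      (runXSideU (φ := φ) cb hn h (Or.inl rfl) Lo Hi i σ₀).lin (φ v) + Pk.A +
        ((runXSideU (φ := φ) cb hn h (Or.inl rfl) Lo Hi i σ₀).s : ℤ) *
          coef (runXSideU (φ := φ) cb hn h (Or.inl rfl) Lo Hi i σ₀).cα (runXSideU (φ := φ) cb hn h (Or.inl rfl) Lo Hi i σ₀).cβ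
            (runXSideU (φ := φ) cb hn h (Or.inl rfl) Lo Hi i σ₀).a ≤
      (runXSideU (φ := φ) cb hn h (Or.inl rfl) Lo Hi i σ₀).lin (φ c))
    (kk : ℕ) (hNk : kk * (Δ + 1) ^ (2 * rs) ≤ Nk) (hkδ : (1 - (q : ℝ) ^ (1 + Δ * cS + cS * cU)) ^ kk ≤ δ) (hδ : 0 < δ)
    -- the depth budget of the plain windows
    (hr₀L : Pk.r₀ + 3 ≤ L') (hL'E : L' ≤ E₀)
    -- the rooms of the regions with one unit of margin (for the plain windows)
    (hrdA' : ∀ du : MDir, ∀ k ≤ NA,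
      let lo := dLo 1 1 0 (-((vLocPrmD n ℓ h vα eA WA L0A NA).toLoc.L k + (vLocPrmD n ℓ h vα eA WA L0A NA).e + (vLocPrmD n ℓ h vα eA WA L0A NA).La)) ((vLocPrmD n ℓ h vα eA WA L0A NA).toLoc.L k + (vLocPrmD n ℓ h vα eA WA L0A NA).e + (vLocPrmD n ℓ h vα eA WA L0A NA).La)
        (-((vLocPrmD n ℓ h vα eA WA L0A NA).Wk k + (vLocPrmD n ℓ h vα eA WA L0A NA).e + (vLocPrmD n ℓ h vα eA WA L0A NA).Lb)) ((vLocPrmD n ℓ h vα eA WA L0A NA).Wk k + (vLocPrmD n ℓ h vα eA WA L0A NA).e + (vLocPrmD n ℓ h vα eA WA L0A NA).Lb)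
      let hi := dHi 1 1 0 (-((vLocPrmD n ℓ h vα eA WA L0A NA).toLoc.L k + (vLocPrmD n ℓ h vα eA WA L0A NA).e + (vLocPrmD n ℓ h vα eA WA L0A NA).La)) ((vLocPrmD n ℓ h vα eA WA L0A NA).toLoc.L k + (vLocPrmD n ℓ h vα eA WA L0A NA).e + (vLocPrmD n ℓ h vα eA WA L0A NA).La)
        (-((vLocPrmD n ℓ h vα eA WA L0A NA).Wk k + (vLocPrmD n ℓ h vα eA WA L0A NA).e + (vLocPrmD n ℓ h vα eA WA L0A NA).Lb)) ((vLocPrmD n ℓ h vα eA WA L0A NA).Wk k + (vLocPrmD n ℓ h vα eA WA L0A NA).e + (vLocPrmD n ℓ h vα eA WA L0A NA).Lb)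
      (sgOf du = 1 → -(5 * (P.r du.1 : ℤ)) + 1 ≤ rdLo A n h vα vβ c₀' c₁' D lo hi du.1 ∧ rdHi A n h vα vβ c₀' c₁' D lo hi du.1 ≤ 22 * (P.r du.1 : ℤ) - 1) ∧
      (sgOf du = -1 → -(5 * (P.r du.1 : ℤ)) + 1 ≤ -rdHi A n h vα vβ c₀' c₁' D lo hi du.1 ∧ -rdLo A n h vα vβ c₀' c₁' D lo hi du.1 ≤ 22 * (P.r du.1 : ℤ) - 1) ∧
      (-(2 * (P.r (oth du.1) : ℤ)) + 1 ≤ rdLo A n h vα vβ c₀' c₁' D lo hi (oth du.1) ∧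
        rdHi A n h vα vβ c₀' c₁' D lo hi (oth du.1) ≤ 2 * (P.r (oth du.1) : ℤ) - 1))
    (hrd₂' : ∀ du : MDir, ∀ k ≤ NB,
      let lo := dLo 0 1 0 (-((xLocPrm n ℓ h eA WB L0B NB).L k + (xLocPrm n ℓ h eA WB L0B NB).e + (xLocPrm n ℓ h eA WB L0B NB).La)) ((xLocPrm n ℓ h eA WB L0B NB).L k + (xLocPrm n ℓ h eA WB L0B NB).e + (xLocPrm n ℓ h eA WB L0B NB).La) (-((xLocPrm n ℓ h eA WB L0B NB).Wk k + (xLocPrm n ℓ h eA WB L0B NB).e + (xLocPrm n ℓ h eA WB L0B NB).Lb)) ((xLocPrm n ℓ h eA WB L0B NB).Wk k + (xLocPrm n ℓ h eA WB L0B NB).e + (xLocPrm n ℓ h eA WB L0B NB).Lb)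
      let hi := dHi 0 1 0 (-((xLocPrm n ℓ h eA WB L0B NB).L k + (xLocPrm n ℓ h eA WB L0B NB).e + (xLocPrm n ℓ h eA WB L0B NB).La)) ((xLocPrm n ℓ h eA WB L0B NB).L k + (xLocPrm n ℓ h eA WB L0B NB).e + (xLocPrm n ℓ h eA WB L0B NB).La) (-((xLocPrm n ℓ h eA WB L0B NB).Wk k + (xLocPrm n ℓ h eA WB L0B NB).e + (xLocPrm n ℓ h eA WB L0B NB).Lb)) ((xLocPrm n ℓ h eA WB L0B NB).Wk k + (xLocPrm n ℓ h eA WB L0B NB).e + (xLocPrm n ℓ h eA WB L0B NB).Lb)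
      (sgOf du = 1 → -(5 * (P.r du.1 : ℤ)) + 1 ≤ rdLo A n h vα vβ c₀' c₁' D lo hi du.1 ∧ rdHi A n h vα vβ c₀' c₁' D lo hi du.1 ≤ 22 * (P.r du.1 : ℤ) - 1) ∧
      (sgOf du = -1 → -(5 * (P.r du.1 : ℤ)) + 1 ≤ -rdHi A n h vα vβ c₀' c₁' D lo hi du.1 ∧ -rdLo A n h vα vβ c₀' c₁' D lo hi du.1 ≤ 22 * (P.r du.1 : ℤ) - 1) ∧
      (-(2 * (P.r (oth du.1) : ℤ)) + 1 ≤ rdLo A n h vα vβ c₀' c₁' D lo hi (oth du.1) ∧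
        rdHi A n h vα vβ c₀' c₁' D lo hi (oth du.1) ≤ 2 * (P.r (oth du.1) : ℤ) - 1))
    (hrdB' : ∀ du : MDir, ∀ j ≤ (bandNw n ℓ h vα eA qx Nx qy Ny Wx Wmy Wpy du).N,
      let Bd := bandNw n ℓ h vα eA qx Nx qy Ny Wx Wmy Wpy du
      let lo := dLo du.1 (sgOf du) 0 (Bd.aLo j - Bd.ea - Bd.La) (Bd.aHi j + Bd.ea + Bd.La) (Bd.bLo j - Bd.eb - Bd.Lb) (Bd.bHi j + Bd.eb + Bd.Lb)
      let hi := dHi du.1 (sgOf du) 0 (Bd.aLo j - Bd.ea - Bd.La) (Bd.aHi j + Bd.ea + Bd.La) (Bd.bLo j - Bd.eb - Bd.Lb) (Bd.bHi j + Bd.eb + Bd.Lb)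
      (sgOf du = 1 → -(5 * (P.r du.1 : ℤ)) + 1 ≤ rdLo A n h vα vβ c₀' c₁' D lo hi du.1 ∧ rdHi A n h vα vβ c₀' c₁' D lo hi du.1 ≤ 22 * (P.r du.1 : ℤ) - 1) ∧
      (sgOf du = -1 → -(5 * (P.r du.1 : ℤ)) + 1 ≤ -rdHi A n h vα vβ c₀' c₁' D lo hi du.1 ∧ -rdLo A n h vα vβ c₀' c₁' D lo hi du.1 ≤ 22 * (P.r du.1 : ℤ) - 1) ∧
      (-(2 * (P.r (oth du.1) : ℤ)) + 1 ≤ rdLo A n h vα vβ c₀' c₁' D lo hi (oth du.1) ∧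
        rdHi A n h vα vβ c₀' c₁' D lo hi (oth du.1) ≤ 2 * (P.r (oth du.1) : ℤ) - 1))
    -- THE INPUTS AT EVERY CENTRE: zone, exit links, long top pieces (both signs, split `vα`), long side halves (both signs)
    (hzone : ∀ c, 1 - δ ^ 2 < (bondPercolation G q).real (UniqZone.zone G (Λc c) kz Mz))
    (hexit : ∀ c (i : Fin 2) (σ₀ : ℤˣ), 1 - δ ^ 2 < (bondPercolation G q).real (linkIn (↑(Rg c) : Set V) (Λc c kz) (Pex i σ₀ c)))
    (hlongT : ∀ c (σ τ : ℤ), σ = 1 ∨ σ = -1 → τ = 1 ∨ τ = -1 → 1 - δ ^ 2 < (bondPercolation G q).real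
      (linkIn (pgramPrism G φ c n h (3 * ℓ) Rl) (Λc c kz) (pgTopPieceW G φ c n h ℓ Rl σ τ vα)))
    (hlongS : ∀ c (σ τ : ℤ), σ = 1 ∨ σ = -1 → τ = 1 ∨ τ = -1 → 1 - δ ^ 2 < (bondPercolation G q).real
      (linkIn (pgramPrism G φ c n h (3 * ℓ) Rl) (Λc c kz) (pgSideHalfW G φ c n h ℓ Rl σ (σ * τ)))) :
    ReachOblRHN G nmax (⟨cellGeomSG₂b G F P t (concRadii2N P gap gap' E₀ L' off) b₀, q, δc⟩ : KSchA V ℕ)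
      (faceDataSG G F P t (concRadii2N P gap gap' E₀ L' off)) Δ δ := by
  refine reachOblRHN_negSG₂b hstep hlipφ hA hn hm hc₀' hc₁' hD hκ F hFdef hlipF hws hF0 P gap gap' E₀ L' off q δc b₀ hb hΛ hgap hgapc hoff hE₀ hgapL hcol
    cOf hcF hcQ hcD hgapC (vLocPrmD n ℓ h vα eA WA L0A NA) (vLocPrmD_ok hn hvn hWn heA L0A NA) (vLocPrmD_dL hvn eA WA L0A NA) ha hBx hb' haW hbL
    (xLocPrm n ℓ h eA WB L0B NB) (xLocPrm_ok heAn hWB L0B NB) (bandNw n ℓ h vα eA qx Nx qy Ny Wx Wmy Wpy) (bandNw_ok hn hvn hlay eA qx Nx qy Ny hWx hWmy hWpy)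
    (bandNw_eb n ℓ h vα eA qx Nx qy Ny Wx Wmy Wpy) (bandNw_ea n ℓ h vα eA qx Nx qy Ny Wx Wmy Wpy) hjoin hreg hjoinA hrdA hrd₂ hrdB hrdL hbr zB hzB hZ hrdZ hE₀Z hlen
    (Rlev := Rlev) (Nk := Nk) (j₀ := j₀) (j₁ := j₁) hRl hRl hj hcount hη hRex hsch ?_ ?_
  · -- THE KIT CLAUSES OF SEGMENT A: the signed v-rounds
    set Λ := concRadii2N P gap gap' E₀ L' off with hΛdef
    set S : KSchA V ℕ := ⟨cellGeomSG₂b G F P t Λ b₀, q, δc⟩ with hSdef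
    set FD := faceDataSG G F P t Λ with hFDdef
    intro ω m e hc hV du hdu Ω' Sf' hlipR' Pd hPo hPS hPRlev hPdN hPj₀ hPj₁ hcover k hk j hjm
    have hr₀1 : 1 ≤ Pk.r₀ := by omega
    set α := S.aOf₁ G (S.hst₂ G ω m) e with hαdef
    set β := S.aOf₂ G (S.hst₂ G ω m) e with hβdef
    set y := tgt e with hydef
    -- the level window
    have hjj : j ≤ Pd.j₁ := (Finset.mem_Icc.1 hjm).2
    have hj0 : tanOff Pk.ℓs Pk.M ≤ j := by rw [hPj₀] at hjm; exact hj₀T.trans (Finset.mem_Icc.1 hjm).1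
    have hje : j + (Pk.N * (tanOff Pk.ℓs Pk.M + 1) + Pk.N * Pk.d + KCmax) ≤ eA := by rw [hPj₁] at hjj; omega
    have hjeA : j ≤ eA := by omega
    have hN' : kk * (Δ + 1) ^ (2 * rs) ≤ Pd.N := by rw [hPdN]; exact hNk
    set SA := (vLocPrmD n ℓ h vα eA WA L0A NA).scheduleN 1 0 (vLocPrmD_ok hn hvn hWn heA L0A NA) (vLocPrmD_dL hvn eA WA L0A NA) with hSAdef
    have hNA : SA.toFrame.N = NA := rfl
    have hkA : k ≤ NA := by rw [hNA] at hk; exact hk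
    have hR'A : SA.R' = eA := rfl
    -- the habitat facts of the step and the widths of the level
    obtain ⟨h1, h2, h3⟩ := hrdA' du k hkA
    obtain ⟨hfull, hDrΩ, hsub, hXD, hPD, hPT, hfarT, hpadT⟩ := habStep_negSG₂b hlipφ hA hn hm hc₀' hc₁' hD F hFdef hlipF hws hF0 P gap gap'
        E₀ L' off q δc b₀ hb hΛ hgap hgapc hoff hE₀ cOf hcF hr₀L hL'E hr₀1 ω m e hc hV du hdu α β y rfl rfl rfl _ _ h1 h2 h3 SA k hkA rfl j (by rw [hR'A]; exact hjeA) Pd hcover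
    obtain ⟨hwide, hdw, hDw⟩ := level_widthsB SA (hkA.trans (Nat.le_succ _)) Pk hj0 hD1 hT' (KCmax := KCmax) (Rs := Rs)
    set c₀ := cOf α y with hc₀def
    set Rw := Erad gap gap' E₀ (nQ α y) - L' + Pk.r₀ with hRwdef
    have hRr₀ : Pk.r₀ ≤ Rw := Nat.le_add_left _ _
    exact hkits_vlocDHab hlipφ hstep hfr hκc hΔ hδ hn c₀ h hκ hvn hWn heA L0A NA Pk hPN hAk hd1 hD1 hD2 hDρ hℓk hWk hKmax hKCmax hR'k hwide hdw hDw
      hT hT' hr₀ hRr₀ hrs hcS (by show j + _ ≤ SA.R'; rw [hR'A]; exact hje) hRlreach le_rfl (by omega) Rg hRg hRgcard hcU1 Λc kz hkn hΛz hZc hclear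
      Pex (hPex c₀ _ _) hfull kk Pd.o Pd.Sfin hDrΩ hsub hPD hXD hPT hpadT hfarT hN' hkδ hzone hexit hlongT
  · -- THE KIT CLAUSES OF SEGMENT 2: the u-rounds (`k ≤ NB`) or the band (`k = NB + 1 + j'`)
    set Λ := concRadii2N P gap gap' E₀ L' off with hΛdef
    set S : KSchA V ℕ := ⟨cellGeomSG₂b G F P t Λ b₀, q, δc⟩ with hSdef
    set FD := faceDataSG G F P t Λ with hFDdef
    intro ω m e hc hV du hdu Ω' Sf' hlipR' Pd hPo hPS hPRlev hPdN hPj₀ hPj₁ hcover k hk j hjm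
    have hr₀1 : 1 ≤ Pk.r₀ := by omega
    set α := S.aOf₁ G (S.hst₂ G ω m) e with hαdef
    set β := S.aOf₂ G (S.hst₂ G ω m) e with hβdef
    set y := tgt e with hydef
    -- the level window
    have hjj : j ≤ Pd.j₁ := (Finset.mem_Icc.1 hjm).2
    have hj0 : tanOff Pk.ℓs Pk.M ≤ j := by rw [hPj₀] at hjm; exact hj₀T.trans (Finset.mem_Icc.1 hjm).1
    have hje : j + (Pk.N * (tanOff Pk.ℓs Pk.M + 1) + Pk.N * Pk.d + KCmax) ≤ eA := by rw [hPj₁] at hjj; omega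
    have hjeA : j ≤ eA := by omega
    have hN' : kk * (Δ + 1) ^ (2 * rs) ≤ Pd.N := by rw [hPdN]; exact hNk
    set SB := (xLocPrm n ℓ h eA WB L0B NB).scheduleN 0 0 (xLocPrm_ok heAn hWB L0B NB) with hSBdef
    set Bd := bandNw n ℓ h vα eA qx Nx qy Ny Wx Wmy Wpy du with hBddef
    set SC := Bd.scheduleN du.1 (sgOf_sign du) 0 (bandNw_ok hn hvn hlay eA qx Nx qy Ny hWx hWmy hWpy du) (bandNw_eb n ℓ h vα eA qx Nx qy Ny Wx Wmy Wpy du) with hSCdef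
    set S2 := corrRunSchedS (xLocPrm n ℓ h eA WB L0B NB) (xLocPrm_ok heAn hWB L0B NB) Bd du.1 (sgOf_sign du)
      (bandNw_ok hn hvn hlay eA qx Nx qy Ny hWx hWmy hWpy du) (bandNw_eb n ℓ h vα eA qx Nx qy Ny Wx Wmy Wpy du) (bandNw_ea n ℓ h vα eA qx Nx qy Ny Wx Wmy Wpy du) (hjoin du) (hreg du) with hS2def
    have hN2 : S2.toFrame.N = NB + 1 + Bd.N := rfl
    have hk2 : k ≤ NB + 1 + Bd.N := by rw [hN2] at hk; exact hk
    have hR'2 : S2.R' = eA := rfl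
    have hjR : j ≤ S2.R' := by rw [hR'2]; exact hjeA
    obtain ⟨hwide, hdw, hDw⟩ := level_widthsB S2 (hk2.trans (Nat.le_succ _)) Pk hj0 hD1 hT' (KCmax := KCmax) (Rs := Rs)
    have hright := corrRunSchedS_right (xLocPrm n ℓ h eA WB L0B NB) (xLocPrm_ok heAn hWB L0B NB) Bd du.1 (sgOf_sign du)
      (bandNw_ok hn hvn hlay eA qx Nx qy Ny hWx hWmy hWpy du) (bandNw_eb n ℓ h vα eA qx Nx qy Ny Wx Wmy Wpy du) (bandNw_ea n ℓ h vα eA qx Nx qy Ny Wx Wmy Wpy du) (hjoin du) (hreg du)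
    rcases corrRunSchedS_region_cases (xLocPrm n ℓ h eA WB L0B NB) (xLocPrm_ok heAn hWB L0B NB) Bd du.1 (sgOf_sign du)
      (bandNw_ok hn hvn hlay eA qx Nx qy Ny hWx hWmy hWpy du) (bandNw_eb n ℓ h vα eA qx Nx qy Ny Wx Wmy Wpy du) (bandNw_ea n ℓ h vα eA qx Nx qy Ny Wx Wmy Wpy du) (hjoin du) (hreg du) hk2 with
      ⟨hkB, hrg⟩ | ⟨j', hj'N, hj', hrg⟩
    · -- a u-round: the frame's corners are the rounds' corners
      obtain ⟨h1, h2, h3⟩ := hrd₂' du k hkB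
      obtain ⟨hfull, hDrΩ, hsub, hXD, hPD, hPT, hfarT, hpadT⟩ := habStep_negSG₂b hlipφ hA hn hm hc₀' hc₁' hD F hFdef hlipF hws hF0 P gap gap'
        E₀ L' off q δc b₀ hb hΛ hgap hgapc hoff hE₀ cOf hcF hr₀L hL'E hr₀1 ω m e hc hV du hdu α β y rfl rfl rfl _ _ h1 h2 h3 S2 k hk2 (hrg.trans rfl) j hjR Pd hcover
      set c₀ := cOf α y with hc₀def
      set Rw := Erad gap gap' E₀ (nQ α y) - L' + Pk.r₀ with hRwdef
      have hRr₀ : Pk.r₀ ≤ Rw := Nat.le_add_left _ _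
      have hlo : S2.lo k = SB.lo k := by
        show pw (xLocPrm n ℓ h eA WB L0B NB).N SB.lo SC.lo k = _; exact pw_of_le _ _ hkB
      have hhi : S2.hi k = SB.hi k := by
        show pw (xLocPrm n ℓ h eA WB L0B NB).N SB.hi SC.hi k = _; exact pw_of_le _ _ hkB
      have hregB : S2.region k = SB.region k := hrg
      rw [stepLF_eq_winLDataIn hlipR' Ω' Pd S2.toFrame k hlo hhi]
      rw [hlo, hhi] at hfull hXD hpadT hfarT hwide hdw hDw
      have hPD' : Win G (runX φ c₀ n h 1) t (SB.region k) Rw ⊆ (planarWindowIn hlipR' Ω').stepDF S2.toFrame k := by rw [← hregB]; exact hPD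
      have hPT' : Win G (runX φ c₀ n h 1) t (SB.core (k + 1)) Rw ⊆ Pd.coreEF (planarWindowIn hlipR' Ω') S2.toFrame k := by
        intro v hv
        obtain ⟨hvB, hvP⟩ := (mem_Win G _).1 hv
        by_cases hk1 : k + 1 ≤ NB
        · have hc : S2.core (k + 1) = SB.core (k + 1) := (corrRunSchedS_left (xLocPrm n ℓ h eA WB L0B NB) (xLocPrm_ok heAn hWB L0B NB) Bd du.1
            (sgOf_sign du) (bandNw_ok hn hvn hlay eA qx Nx qy Ny hWx hWmy hWpy du) (bandNw_eb n ℓ h vα eA qx Nx qy Ny Wx Wmy Wpy du) (bandNw_ea n ℓ h vα eA qx Nx qy Ny Wx Wmy Wpy du)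
            (hjoin du) (hreg du) hk1).2.2
          exact hPT ((mem_Win G _).2 ⟨hvB, by rw [hc]; exact hvP⟩)
        · have hkB' : k ≤ NB := hkB
          have hkN : k = NB := by omega
          have hc : S2.core (k + 1) = SC.core 0 := by
            rw [hkN, show NB + 1 = (xLocPrm n ℓ h eA WB L0B NB).N + 1 + 0 from rfl]
            exact (hright 0).2.2
          rw [hkN] at hvP
          exact hPT ((mem_Win G _).2 ⟨hvB, by rw [hc]; exact hjoin du hvP⟩)
      exact hkits_locHab hlipφ hstep hfr hκc hΔ hδ hn c₀ h hκ heAn hWB L0B NB Pk hPN hAk hd1 hD1 hD2 hDρ hℓk hWk hKmax hKCmax hR'k hwide hdw hDw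
        hT hT' hr₀ hRr₀ hrs hcS (by show j + _ ≤ (xLocPrm n ℓ h eA WB L0B NB).e; exact hje) hRlreach le_rfl (by omega) Rg hRg hRgcard hcU1 Λc kz hkn
        hΛz hZc hMz Pex (hPex c₀ _ _) hfull kk Pd.o Pd.Sfin hDrΩ hsub hPD' hXD hPT' hpadT hfarT hN' hkδ hzone hexit hlongS
    · -- a band step `k = NB + 1 + j'`
      obtain ⟨h1, h2, h3⟩ := hrdB' du j' hj'N
      obtain ⟨hfull, hDrΩ, hsub, hXD, hPD, hPT, hfarT, hpadT⟩ := habStep_negSG₂b hlipφ hA hn hm hc₀' hc₁' hD F hFdef hlipF hws hF0 P gap gap'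
        E₀ L' off q δc b₀ hb hΛ hgap hgapc hoff hE₀ cOf hcF hr₀L hL'E hr₀1 ω m e hc hV du hdu α β y rfl rfl rfl _ _ h1 h2 h3 S2 k hk2 (hrg.trans rfl) j hjR Pd hcover
      set c₀ := cOf α y with hc₀def
      set Rw := Erad gap gap' E₀ (nQ α y) - L' + Pk.r₀ with hRwdef
      have hRr₀ : Pk.r₀ ≤ Rw := Nat.le_add_left _ _
      have hlo : S2.lo k = SC.lo j' := by rw [hj']; exact pw_add _ _ _ _
      have hhi : S2.hi k = SC.hi j' := by rw [hj']; exact pw_add _ _ _ _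
      have hregC : S2.region k = SC.region j' := hrg
      have hcoreC : S2.core (k + 1) = SC.core (j' + 1) := by
        rw [hj', show (xLocPrm n ℓ h eA WB L0B NB).N + 1 + j' + 1 = (xLocPrm n ℓ h eA WB L0B NB).N + 1 + (j' + 1) by omega]
        exact (hright (j' + 1)).2.2
      rw [stepLF_eq_winLDataIn hlipR' Ω' Pd S2.toFrame k hlo hhi]
      rw [hlo, hhi] at hfull hXD hpadT hfarT hwide hdw hDw
      have hPD' : Win G (runX φ c₀ n h 1) t (SC.region j') Rw ⊆ (planarWindowIn hlipR' Ω').stepDF S2.toFrame k := by rw [← hregC]; exact hPD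
      have hPT' : Win G (runX φ c₀ n h 1) t (SC.core (j' + 1)) Rw ⊆ Pd.coreEF (planarWindowIn hlipR' Ω') S2.toFrame k := by
        rw [← hcoreC]; exact hPT
      have hjeC : j + (Pk.N * (tanOff Pk.ℓs Pk.M + 1) + Pk.N * Pk.d + KCmax) ≤ SC.R' := by
        show j + _ ≤ Bd.ea; rw [hBddef, bandNw_ea]; exact hje
      -- by the corridor axis: x-band (`du.1 = 0`) or y′-band (`du.1 = 1`)
      obtain ⟨i, sg⟩ := du
      fin_cases i
      · exact hkits_xbandWHab hlipφ hstep hfr hκc hΔ hδ hn c₀ h hκ ℓ eA qx Nx (sgOf_sign (0, sg)) hWx hWx Pk hPN hAk hd1 hD1 hD2 hDρ hℓk hWk hKmax hKCmax hR'k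
          hwide hdw hDw hT hT' hr₀ hRr₀ hrs hcS hjeC hRlreach le_rfl (by omega) Rg hRg hRgcard hcU1 Λc kz hkn hΛz hZc hMz Pex (hPex c₀ _ _) hfull kk
          Pd.o Pd.Sfin hDrΩ hsub hPD' hXD hPT' hpadT hfarT hN' hkδ hzone hexit (fun c τ hτ => hlongS c _ τ (sgOf_sign (0, sg)) hτ)
      · exact hkits_ybandWHab hlipφ hstep hfr hκc hΔ hδ hn c₀ h hκ hvn hlay eA qy Ny (sgOf_sign (1, sg)) hWmy hWpy Pk hPN hAk hd1 hD1 hD2 hDρ hℓk hWk hKmax hKCmax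
          hR'k hwide hdw hDw hT hT' hr₀ hRr₀ hrs hcS hjeC hRlreach le_rfl (by omega) Rg hRg hRgcard hcU1 Λc kz hkn hΛz hZc hclear Pex (hPex c₀ _ _) hfull kk
          Pd.o Pd.Sfin hDrΩ hsub hPD' hXD hPT' hpadT hfarT hN' hkδ hzone hexit (fun c τ hτ => hlongT c _ τ (sgOf_sign (1, sg)) hτ)

end Skelφ

end Transplant

end Summit.CriticalPhenomena.PercolationContinuityZ3.Theorems

end
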